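import Literature.MathematicalPhysics.QuantumLattice.YangMillsHeatFlowGradientEnergy
import HarnessLib

/-!
# Localized space-time `L²` bounds for pairs `(Q, H)` with `∂ₜQ − ΔQ ≤ −2H + L Q`

QuantumLattice support file (everything proved; no definitions, no named facts) on the proof
path of `Literature.MathematicalPhysics.QuantumLattice.Waldron2019_yangMillsFlow_flatTorus`
(A. Waldron, Invent. math. 217 (2019)), §3: the generic energy-estimate step of the derivative
estimates in Prop. 3.1 ([instantons] Lemma 3.1, after Bernstein–Hamilton–Weinkove). For the
Bochner quantities `Q = ∑‖ψ_α‖²` of the flow (`e`, `|∇F|²`, `|D^*F|²`, …) one has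
`∂ₜQ − ΔQ ≤ −2H + L Q` with `H = ∑‖Dψ_α‖²` the next-order quantity and the Kato-type bound
`‖∇Q‖² ≤ 4 Q H`; integrating against `φ²` and in time bounds `∫∫ φ²H` by lower-order data.

* `continuous_deriv_tslice_of_contDiffOn`, `hasDerivAt_integral_mul_of_contDiffOn` — calculus
  for `s ↦ ∫ ψ q(s, ·)` with `q` jointly smooth;
* `norm_fderiv_sum_norm_sq_sq_le` — Kato for families: `‖∇∑‖ψ_α‖²‖² ≤ 4(∑‖ψ_α‖²)(∑‖D_lψ_α‖²)`;
* `integral_sq_mul_laplacian_le_of_kato` — `∫ φ²ΔQ ≤ ∫ (φ²H + 4Q‖∇φ‖²)`;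
* `integral_sq_mul_le_of_subsolution_pair` — fixed time:
  `∫φ²H ≤ −∫φ²∂ₜQ + 4K²∫_U Q + L∫φ²Q`;
* `intervalIntegral_integral_sq_mul_le_of_subsolution_pair` — **the space-time bound**
  `∫_{t₁}^{t₂}∫φ²H ≤ ∫φ²Q(t₁) + 4K²∫_{t₁}^{t₂}∫_U Q + L∫_{t₁}^{t₂}∫φ²Q`.

References: A. Waldron, Calc. Var. PDE 55 (2016), Lemma 3.1 [Waldron2016]; A. Waldron,
Invent. math. 217 (2019), Prop. 3.1 [Waldron2019].
-/

noncomputable section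

open scoped ContDiff Topology RealInnerProductSpace Matrix NNReal ENNReal
open Set Filter MeasureTheory Metric

namespace Literature.MathematicalPhysics.QuantumLattice

section ScalarEnergy

open scoped Matrix.Norms.Frobenius

attribute [local instance] frobeniusInnerProductSpace

variable {m : Type*} [Fintype m] [DecidableEq m]
variable {E : Type*} [NormedAddCommGroup E] [InnerProductSpace ℝ E] [FiniteDimensional ℝ E]
  [MeasurableSpace E] [BorelSpace E]
variable {ι : Type*} [Fintype ι]

omit [Fintype ι] [FiniteDimensional ℝ E] [MeasurableSpace E] [BorelSpace E] in
/-- **Continuity in space of the time derivative** of a jointly smooth `q` (`𝒯` open, `t ∈ 𝒯`).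
[folklore] -/
theorem continuous_deriv_tslice_of_contDiffOn {q : ℝ → E → ℝ} {𝒯 : Set ℝ} (h𝒯 : IsOpen 𝒯)
    (hq : ContDiffOn ℝ ∞ (fun p : ℝ × E => q p.1 p.2) (𝒯 ×ˢ (univ : Set E))) {t : ℝ}
    (ht : t ∈ 𝒯) : Continuous fun y => deriv (fun s => q s y) t := by
  have hO : IsOpen (𝒯 ×ˢ (univ : Set E)) := h𝒯.prod isOpen_univ
  have hrate_c : ContinuousOn (fun p : ℝ × E => fderiv ℝ (fun p : ℝ × E => q p.1 p.2) p
      ((1 : ℝ), (0 : E))) (𝒯 ×ˢ (univ : Set E)) :=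
    ((ContinuousLinearMap.apply ℝ ℝ ((1 : ℝ), (0 : E))).continuous.comp_continuousOn
      (hq.continuousOn_fderiv_of_isOpen hO (by simp)))
  have heq : (fun y => deriv (fun s => q s y) t) =
      fun y => fderiv ℝ (fun p : ℝ × E => q p.1 p.2) (t, y) ((1 : ℝ), (0 : E)) :=
    funext fun y => (hasDerivAt_timeSlice hO hq (by simp) ⟨ht, mem_univ y⟩).deriv
  rw [heq]
  exact continuous_slice_of_continuousOn_slab hrate_c ht

omit [Fintype ι] in
/-- **Differentiating `s ↦ ∫ ψ q(s, ·)`** for `q` jointly smooth on `𝒯 × E` (`𝒯` open) and a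
continuous compactly supported weight `ψ`: the derivative at `t ∈ 𝒯` is `∫ ψ ∂ₜq(t, ·)`.
[folklore] -/
theorem hasDerivAt_integral_mul_of_contDiffOn {q : ℝ → E → ℝ} {𝒯 : Set ℝ} (h𝒯 : IsOpen 𝒯)
    (hq : ContDiffOn ℝ ∞ (fun p : ℝ × E => q p.1 p.2) (𝒯 ×ˢ (univ : Set E)))
    {ψ : E → ℝ} (hψ : Continuous ψ) (hψc : HasCompactSupport ψ) {t : ℝ} (ht : t ∈ 𝒯) :
    HasDerivAt (fun s => ∫ y, ψ y * q s y) (∫ y, ψ y * deriv (fun s => q s y) t) t := by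
  have hO : IsOpen (𝒯 ×ˢ (univ : Set E)) := h𝒯.prod isOpen_univ
  set rate : ℝ × E → ℝ := fun p => fderiv ℝ (fun p : ℝ × E => q p.1 p.2) p ((1 : ℝ), (0 : E))
    with hrate
  have hrate_c : ContinuousOn rate (𝒯 ×ˢ (univ : Set E)) :=
    ((ContinuousLinearMap.apply ℝ ℝ ((1 : ℝ), (0 : E))).continuous.comp_continuousOn
      (hq.continuousOn_fderiv_of_isOpen hO (by simp)))
  have hderiv : ∀ s ∈ 𝒯, ∀ y, HasDerivAt (fun s' => (fun p : ℝ × E => q p.1 p.2) (s', y))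
      (rate (s, y)) s := fun s hs y => hasDerivAt_timeSlice hO hq (by simp) ⟨hs, mem_univ y⟩
  have h := hasDerivAt_integral_mul_of_hasDerivAt_slab h𝒯 hq.continuousOn hrate_c hderiv hψ hψc ht
  have hrate_eq : ∀ y, rate (t, y) = deriv (fun s => q s y) t := fun y =>
    ((hderiv t ht y).deriv).symm
  simp only [hrate_eq] at h
  exact h

omit [MeasurableSpace E] [BorelSpace E] in
/-- **Kato-type bound for a sum of squared norms of sections**: for a `C¹` `𝔲(m)`-valued
connection, differentiable sections `ψ_α` and an orthonormal frame `b`,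
`‖∇ ∑_α ‖ψ_α‖²‖² ≤ 4 (∑_α ‖ψ_α‖²) (∑ₗ∑_α ‖D_lψ_α‖²)` (`∂_l ∑‖ψ_α‖² = 2∑⟨ψ_α, D_lψ_α⟩` and
Cauchy–Schwarz). [folklore] -/
theorem norm_fderiv_sum_norm_sq_sq_le {κ : Type*} [Fintype κ] (b : OrthonormalBasis ι ℝ E)
    {A : Connection E (Matrix m m ℂ)} (hval : A.IsValuedIn (skewAdjoint.submodule ℝ (Matrix m m ℂ)))
    {ψ : κ → E → Matrix m m ℂ} (y : E) (hψ : ∀ a, DifferentiableAt ℝ (ψ a) y) :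
    ‖fderiv ℝ (fun z => ∑ a, ‖ψ a z‖ ^ 2) y‖ ^ 2 ≤
      4 * (∑ a, ‖ψ a y‖ ^ 2) * ∑ l, ∑ a, ‖covDeriv A (ψ a) y (b l)‖ ^ 2 := by
  rw [← sum_sq_apply_orthonormalBasis_eq b, Finset.mul_sum]
  refine Finset.sum_le_sum fun l _ => ?_
  have hdl : fderiv ℝ (fun z => ∑ a, ‖ψ a z‖ ^ 2) y (b l) =
      ∑ a, 2 * ⟪ψ a y, covDeriv A (ψ a) y (b l)⟫ := by
    rw [fderiv_fun_sum fun a _ => (hψ a).norm_sq ℝ, FunLike.coe_sum, Finset.sum_apply]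
    exact Finset.sum_congr rfl fun a _ =>
      fderiv_norm_sq_eq_two_inner_covDeriv (hψ a) (b l) (hval y (b l))
  rw [hdl]
  set D : κ → Matrix m m ℂ := fun a => ψ a y with hD
  set G : κ → Matrix m m ℂ := fun a => covDeriv A (ψ a) y (b l) with hG
  have hcs : |∑ a, ⟪D a, G a⟫| ≤ Real.sqrt (∑ a, ‖D a‖ ^ 2) * Real.sqrt (∑ a, ‖G a‖ ^ 2) := by
    have h1 : |∑ a, ⟪D a, G a⟫| ≤ ∑ a, ‖D a‖ * ‖G a‖ :=
      (Finset.abs_sum_le_sum_abs _ _).trans (Finset.sum_le_sum fun a _ => abs_real_inner_le_norm _ _)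
    exact h1.trans (Real.sum_mul_le_sqrt_mul_sqrt Finset.univ (fun a => ‖D a‖) (fun a => ‖G a‖))
  have hD0 : 0 ≤ ∑ a, ‖D a‖ ^ 2 := Finset.sum_nonneg fun a _ => sq_nonneg _
  have hG0 : 0 ≤ ∑ a, ‖G a‖ ^ 2 := Finset.sum_nonneg fun a _ => sq_nonneg _
  have hsum : ∑ a, 2 * ⟪D a, G a⟫ = 2 * ∑ a, ⟪D a, G a⟫ := by rw [Finset.mul_sum]
  rw [hsum]
  have h' := pow_le_pow_left₀ (abs_nonneg _) hcs 2
  rw [sq_abs, mul_pow, Real.sq_sqrt hD0, Real.sq_sqrt hG0] at h'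
  calc (2 * ∑ a, ⟪D a, G a⟫) ^ 2 = 4 * (∑ a, ⟪D a, G a⟫) ^ 2 := by ring
    _ ≤ 4 * ((∑ a, ‖D a‖ ^ 2) * ∑ a, ‖G a‖ ^ 2) := by gcongr
    _ = 4 * (∑ a, ‖D a‖ ^ 2) * ∑ a, ‖G a‖ ^ 2 := by ring

/-- **`∫ φ² ΔQ ≤ ∫ (φ² H + 4 Q ‖∇φ‖²)`** for `C²` functions `Q, H ≥ 0` (`H` continuous) with the
Kato-type bound `‖∇Q‖² ≤ 4 Q H`, and `φ ∈ C¹_c` (integration by parts once and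
`4|φ|√H ‖∇φ‖√Q ≤ φ²H + 4‖∇φ‖²Q`). [folklore] -/
theorem integral_sq_mul_laplacian_le_of_kato (b : OrthonormalBasis ι ℝ E)
    {Q H : E → ℝ} (hQ : ContDiff ℝ 2 Q) (hHc : Continuous H) (hQ0 : ∀ y, 0 ≤ Q y)
    (hH0 : ∀ y, 0 ≤ H y) (hkato : ∀ y, ‖fderiv ℝ Q y‖ ^ 2 ≤ 4 * Q y * H y)
    {φ : E → ℝ} (hφ : ContDiff ℝ 1 φ) (hφc : HasCompactSupport φ) :
    ∫ y, φ y ^ 2 * ∑ l, fderiv ℝ (fun z => fderiv ℝ Q z (b l)) y (b l) ≤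
      ∫ y, (φ y ^ 2 * H y + 4 * Q y * ‖fderiv ℝ φ y‖ ^ 2) := by
  have hf : ∀ l, ContDiff ℝ 1 fun z => fderiv ℝ Q z (b l) := fun l =>
    (hQ.fderiv_right (m := 1) (by norm_num)).clm_apply contDiff_const
  have hQc : Continuous Q := hQ.continuous
  -- the test function `χ = φ²`
  have hχ : ContDiff ℝ 1 fun y => φ y ^ 2 := hφ.pow 2
  have hχc : HasCompactSupport fun y => φ y ^ 2 := hasCompactSupport_sq hφc
  have hdχ : ∀ y i, fderiv ℝ (fun y => φ y ^ 2) y (b i) = 2 * φ y * fderiv ℝ φ y (b i) := by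
    intro y i
    rw [((hφ.differentiable one_ne_zero y).hasFDerivAt.pow 2).fderiv]
    simp only [smul_apply, nsmul_eq_mul, Nat.cast_ofNat, smul_eq_mul, Nat.add_one_sub_one, pow_one]
  -- integration by parts
  rw [integral_mul_sum_fderiv_eq_neg_integral (fun i => b i) hχ hχc hf]
  simp_rw [hdχ]
  rw [← integral_neg]
  -- pointwise bound on the flux
  have hpt : ∀ y, -(∑ i, fderiv ℝ Q y (b i) * (2 * φ y * fderiv ℝ φ y (b i))) ≤
      φ y ^ 2 * H y + 4 * Q y * ‖fderiv ℝ φ y‖ ^ 2 := by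
    intro y
    have hsum : ∑ i, fderiv ℝ Q y (b i) * (2 * φ y * fderiv ℝ φ y (b i)) =
        2 * φ y * ∑ i, fderiv ℝ Q y (b i) * fderiv ℝ φ y (b i) := by
      rw [Finset.mul_sum]
      exact Finset.sum_congr rfl fun i _ => by ring
    have hcs : |∑ i, fderiv ℝ Q y (b i) * fderiv ℝ φ y (b i)| ≤ ‖fderiv ℝ Q y‖ * ‖fderiv ℝ φ y‖ := by
      have h := Real.sum_mul_le_sqrt_mul_sqrt Finset.univ (fun i => fderiv ℝ Q y (b i))
        (fun i => fderiv ℝ φ y (b i))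
      have h' := Real.sum_mul_le_sqrt_mul_sqrt Finset.univ (fun i => -fderiv ℝ Q y (b i))
        (fun i => fderiv ℝ φ y (b i))
      simp only [neg_mul, Finset.sum_neg_distrib, even_two, Even.neg_pow] at h'
      rw [sum_sq_apply_orthonormalBasis_eq b, sum_sq_apply_orthonormalBasis_eq b,
        Real.sqrt_sq (norm_nonneg _), Real.sqrt_sq (norm_nonneg _)] at h h'
      exact abs_le.mpr ⟨by linarith, h⟩
    have hk : ‖fderiv ℝ Q y‖ ≤ 2 * Real.sqrt (Q y) * Real.sqrt (H y) := by
      have h4 : 4 * Q y * H y = (2 * Real.sqrt (Q y) * Real.sqrt (H y)) ^ 2 := by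
        rw [mul_pow, mul_pow, Real.sq_sqrt (hQ0 y), Real.sq_sqrt (hH0 y)]; ring
      have h' : ‖fderiv ℝ Q y‖ ^ 2 ≤ (2 * Real.sqrt (Q y) * Real.sqrt (H y)) ^ 2 := by
        rw [← h4]; exact hkato y
      exact (pow_le_pow_iff_left₀ (norm_nonneg _) (by positivity) two_ne_zero).mp h'
    have hyoung : 2 * |φ y| * ‖fderiv ℝ φ y‖ * (2 * Real.sqrt (Q y) * Real.sqrt (H y)) ≤
        φ y ^ 2 * H y + 4 * Q y * ‖fderiv ℝ φ y‖ ^ 2 := by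
      have hsq := sq_nonneg (|φ y| * Real.sqrt (H y) - 2 * (‖fderiv ℝ φ y‖ * Real.sqrt (Q y)))
      have e1 : (|φ y| * Real.sqrt (H y)) ^ 2 = φ y ^ 2 * H y := by
        rw [mul_pow, sq_abs, Real.sq_sqrt (hH0 y)]
      have e2 : (‖fderiv ℝ φ y‖ * Real.sqrt (Q y)) ^ 2 = Q y * ‖fderiv ℝ φ y‖ ^ 2 := by
        rw [mul_pow, Real.sq_sqrt (hQ0 y)]; ring
      nlinarith [hsq, e1, e2]
    rw [hsum]
    calc -(2 * φ y * ∑ i, fderiv ℝ Q y (b i) * fderiv ℝ φ y (b i))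
        ≤ |2 * φ y * ∑ i, fderiv ℝ Q y (b i) * fderiv ℝ φ y (b i)| := neg_le_abs _
      _ = 2 * |φ y| * |∑ i, fderiv ℝ Q y (b i) * fderiv ℝ φ y (b i)| := by
          rw [abs_mul, abs_mul, abs_two]
      _ ≤ 2 * |φ y| * (‖fderiv ℝ Q y‖ * ‖fderiv ℝ φ y‖) :=
          mul_le_mul_of_nonneg_left hcs (by positivity)
      _ ≤ 2 * |φ y| * (2 * Real.sqrt (Q y) * Real.sqrt (H y) * ‖fderiv ℝ φ y‖) := by gcongr
      _ = 2 * |φ y| * ‖fderiv ℝ φ y‖ * (2 * Real.sqrt (Q y) * Real.sqrt (H y)) := by ring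
      _ ≤ φ y ^ 2 * H y + 4 * Q y * ‖fderiv ℝ φ y‖ ^ 2 := hyoung
  -- integrability and conclusion
  have hdφc : ∀ i, Continuous fun y => fderiv ℝ φ y (b i) := fun i =>
    (hφ.continuous_fderiv one_ne_zero).clm_apply continuous_const
  have hdQc : ∀ i, Continuous fun y => fderiv ℝ Q y (b i) := fun i => (hf i).continuous
  have hI1 : Integrable fun y => -(∑ i, fderiv ℝ Q y (b i) * (2 * φ y * fderiv ℝ φ y (b i))) := by
    refine Integrable.neg (integrable_finsetSum _ fun i _ => ?_)
    have hc : Continuous fun y => fderiv ℝ Q y (b i) * (2 * φ y * fderiv ℝ φ y (b i)) :=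
      (hdQc i).mul ((continuous_const.mul hφ.continuous).mul (hdφc i))
    exact hc.integrable_of_hasCompactSupport
      (((hφc.fderiv_apply (𝕜 := ℝ) (b i)).mul_left).mul_left)
  have hI2 : Integrable fun y => φ y ^ 2 * H y + 4 * Q y * ‖fderiv ℝ φ y‖ ^ 2 := by
    refine Integrable.add ?_ ?_
    · exact ((hφ.continuous.pow 2).mul hHc).integrable_of_hasCompactSupport hχc.mul_right
    · have hc : Continuous fun y => 4 * Q y * ‖fderiv ℝ φ y‖ ^ 2 :=
        (continuous_const.mul hQc).mul ((hφ.continuous_fderiv one_ne_zero).norm.pow 2)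
      exact hc.integrable_of_hasCompactSupport
        (hasCompactSupport_norm_sq (hφc.fderiv (𝕜 := ℝ))).mul_left
  exact integral_mono hI1 hI2 hpt

/-- **The fixed-time inequality for a subsolution pair.** Let `Q, H` be jointly smooth resp.
continuous on `𝒯 × E` (`𝒯` open, `t ∈ 𝒯`), nonnegative, with the Kato-type bound
`‖∇Q(t)‖² ≤ 4 Q(t) H(t)` and `∂ₜQ − ∑ₗ∂ₗ∂ₗQ ≤ −2H + L Q` at time `t` on `{φ ≠ 0}`, for a
`C¹` compactly supported `φ` with `‖∇φ‖ ≤ K` and `∇φ = 0` off the measurable `U ⊆ K_c` (compact).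
Then `∫ φ²H(t) ≤ −∫ φ² ∂ₜQ(t) + 4K² ∫_U Q(t) + L ∫ φ²Q(t)`.
[cite: Waldron2016, Lemma 3.1; Waldron2019, Prop. 3.1] -/
theorem integral_sq_mul_le_of_subsolution_pair (b : OrthonormalBasis ι ℝ E)
    {Q : ℝ → E → ℝ} {H : ℝ → E → ℝ} {𝒯 : Set ℝ} (h𝒯 : IsOpen 𝒯)
    (hQ : ContDiffOn ℝ ∞ (fun p : ℝ × E => Q p.1 p.2) (𝒯 ×ˢ (univ : Set E)))
    (hH : ContinuousOn (fun p : ℝ × E => H p.1 p.2) (𝒯 ×ˢ (univ : Set E)))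
    (hQ0 : ∀ ⦃s : ℝ⦄, s ∈ 𝒯 → ∀ y, 0 ≤ Q s y) (hH0 : ∀ ⦃s : ℝ⦄, s ∈ 𝒯 → ∀ y, 0 ≤ H s y)
    (hkato : ∀ ⦃s : ℝ⦄, s ∈ 𝒯 → ∀ y, ‖fderiv ℝ (Q s) y‖ ^ 2 ≤ 4 * Q s y * H s y)
    {φ : E → ℝ} (hφ : ContDiff ℝ 1 φ) (hφc : HasCompactSupport φ)
    {Kc U : Set E} (hKc : IsCompact Kc) (hUK : U ⊆ Kc) (hU : MeasurableSet U)
    (hφU : ∀ y ∉ U, fderiv ℝ φ y = 0) {K : ℝ} (hK : ∀ y, ‖fderiv ℝ φ y‖ ≤ K)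
    {t : ℝ} (ht : t ∈ 𝒯) {L : ℝ}
    (hineq : ∀ y, φ y ≠ 0 → deriv (fun s => Q s y) t -
        ∑ l, fderiv ℝ (fun z => fderiv ℝ (Q t) z (b l)) y (b l) ≤ -(2 * H t y) + L * Q t y) :
    ∫ y, φ y ^ 2 * H t y ≤
      -(∫ y, φ y ^ 2 * deriv (fun s => Q s y) t) + 4 * K ^ 2 * (∫ y in U, Q t y) +
        L * ∫ y, φ y ^ 2 * Q t y := by
  -- ### continuity of the players
  have hQt : ContDiff ℝ ∞ (Q t) := by
    have : Q t = (fun p : ℝ × E => Q p.1 p.2) ∘ fun y : E => (t, y) := rfl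
    rw [this]
    exact hQ.comp_contDiff (contDiff_const.prodMk contDiff_id) fun y => ⟨ht, mem_univ y⟩
  have htop : ∀ k : ℕ, (k : WithTop ℕ∞) ≤ (⊤ : ℕ∞) := fun k => by exact_mod_cast le_top
  have hQ2 : ContDiff ℝ 2 (Q t) := hQt.of_le (htop 2)
  have hQc : Continuous (Q t) := hQt.continuous
  have hHc : Continuous (H t) := continuous_slice_of_continuousOn_slab hH ht
  have hdec : Continuous fun y => deriv (fun s => Q s y) t :=
    continuous_deriv_tslice_of_contDiffOn h𝒯 hQ ht
  have hlapc : Continuous fun y => ∑ l, fderiv ℝ (fun z => fderiv ℝ (Q t) z (b l)) y (b l) := by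
    refine continuous_finsetSum _ fun l _ => ?_
    have h1 : ContDiff ℝ 1 fun z => fderiv ℝ (Q t) z (b l) :=
      (hQ2.fderiv_right (m := 1) (by norm_num)).clm_apply contDiff_const
    exact (h1.continuous_fderiv one_ne_zero).clm_apply continuous_const
  have hφcont : Continuous φ := hφ.continuous
  have hφ2c : Continuous fun y => φ y ^ 2 := hφcont.pow 2
  have hφ2s : HasCompactSupport fun y => φ y ^ 2 := hasCompactSupport_sq hφc
  have hint : ∀ ⦃g : E → ℝ⦄, Continuous g → Integrable fun y => φ y ^ 2 * g y := fun g hg =>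
    (hφ2c.mul hg).integrable_of_hasCompactSupport hφ2s.mul_right
  -- ### the pointwise inequality
  have hpt : ∀ y, φ y ^ 2 * deriv (fun s => Q s y) t ≤
      φ y ^ 2 * (∑ l, fderiv ℝ (fun z => fderiv ℝ (Q t) z (b l)) y (b l)) -
        2 * (φ y ^ 2 * H t y) + L * (φ y ^ 2 * Q t y) := by
    intro y
    have hφ2 : 0 ≤ φ y ^ 2 := sq_nonneg _
    by_cases hφy : φ y = 0
    · simp [hφy]
    · have h4 := mul_le_mul_of_nonneg_left (hineq y hφy) hφ2
      linarith only [h4]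
  -- ### integrate
  have hi1 := hint hlapc
  have hi2 := hint hHc
  have hi3 : Integrable fun y => L * (φ y ^ 2 * Q t y) := (hint hQc).const_mul _
  have hi2' : Integrable fun y => 2 * (φ y ^ 2 * H t y) := hi2.const_mul 2
  have hi12 : Integrable fun y => φ y ^ 2 * (∑ l, fderiv ℝ (fun z => fderiv ℝ (Q t) z (b l)) y (b l)) -
      2 * (φ y ^ 2 * H t y) := hi1.sub hi2'
  have hsum : Integrable fun y => φ y ^ 2 * (∑ l, fderiv ℝ (fun z => fderiv ℝ (Q t) z (b l)) y (b l)) -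
      2 * (φ y ^ 2 * H t y) + L * (φ y ^ 2 * Q t y) := hi12.add hi3
  have hI1 := integral_mono (hint hdec) hsum hpt
  rw [integral_add hi12 hi3, integral_sub hi1 hi2', MeasureTheory.integral_const_mul,
    MeasureTheory.integral_const_mul] at hI1
  -- `∫ φ² ΔQ ≤ ∫ φ² H + 4 ∫ Q ‖∇φ‖²`
  have hI2 := integral_sq_mul_laplacian_le_of_kato b hQ2 hHc (hQ0 ht) (hH0 ht) (hkato ht) hφ hφc
  have hgradc : Continuous fun y => ‖fderiv ℝ φ y‖ ^ 2 :=
    ((hφ.continuous_fderiv one_ne_zero).norm).pow 2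
  have hgrads : HasCompactSupport fun y => ‖fderiv ℝ φ y‖ ^ 2 :=
    hasCompactSupport_norm_sq (hφc.fderiv (𝕜 := ℝ))
  have hig : Integrable fun y => Q t y * ‖fderiv ℝ φ y‖ ^ 2 :=
    (hQc.mul hgradc).integrable_of_hasCompactSupport hgrads.mul_left
  have hI2' : (∫ y, φ y ^ 2 * ∑ l, fderiv ℝ (fun z => fderiv ℝ (Q t) z (b l)) y (b l)) ≤
      (∫ y, φ y ^ 2 * H t y) + 4 * ∫ y, Q t y * ‖fderiv ℝ φ y‖ ^ 2 := by
    have hi4 : Integrable fun y => 4 * Q t y * ‖fderiv ℝ φ y‖ ^ 2 := by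
      have := hig.const_mul 4; simpa only [mul_assoc] using this
    have hsplit : (∫ y, (φ y ^ 2 * H t y + 4 * Q t y * ‖fderiv ℝ φ y‖ ^ 2)) =
        (∫ y, φ y ^ 2 * H t y) + 4 * ∫ y, Q t y * ‖fderiv ℝ φ y‖ ^ 2 := by
      rw [integral_add hi2 hi4, ← MeasureTheory.integral_const_mul]
      congr 1
      exact integral_congr_ae (ae_of_all _ fun y => by ring)
    rw [← hsplit]; exact hI2
  -- `∫ Q ‖∇φ‖² ≤ K² ∫_U Q`
  have hI3 : (∫ y, Q t y * ‖fderiv ℝ φ y‖ ^ 2) ≤ K ^ 2 * ∫ y in U, Q t y := by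
    have hzero : ∀ y ∉ U, Q t y * ‖fderiv ℝ φ y‖ ^ 2 = 0 := fun y hy => by
      rw [hφU y hy, norm_zero]; ring
    rw [← setIntegral_eq_integral_of_forall_compl_eq_zero hzero, ← integral_const_mul]
    refine setIntegral_mono_on hig.integrableOn
      (((continuous_const.mul hQc).continuousOn.integrableOn_compact hKc).mono_set hUK) hU
      fun y _ => ?_
    have h1 : ‖fderiv ℝ φ y‖ ^ 2 ≤ K ^ 2 := pow_le_pow_left₀ (norm_nonneg _) (hK y) 2
    calc Q t y * ‖fderiv ℝ φ y‖ ^ 2 ≤ Q t y * K ^ 2 := mul_le_mul_of_nonneg_left h1 (hQ0 ht y)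
      _ = K ^ 2 * Q t y := mul_comm _ _
  linarith only [hI1, hI2', hI3]

/-- **The localized space-time `L²` bound for a subsolution pair.** Under the hypotheses of
`integral_sq_mul_le_of_subsolution_pair` at every `t ∈ [t₁, t₂] ⊆ 𝒯` (the differential
inequality `∂ₜQ − ΔQ ≤ −2H + LQ` on `[t₁,t₂] × {φ ≠ 0}`),
`∫_{t₁}^{t₂}∫ φ²H ≤ ∫ φ²Q(t₁) + 4K² ∫_{t₁}^{t₂}∫_U Q + L ∫_{t₁}^{t₂}∫ φ²Q`
(the fixed-time inequality integrated in time; `∫ (d/dt)∫φ²Q = ∫φ²Q(t₂) − ∫φ²Q(t₁)`, `∫φ²Q(t₂) ≥ 0`).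
[cite: Waldron2016, Lemma 3.1; Waldron2019, Prop. 3.1] -/
theorem intervalIntegral_integral_sq_mul_le_of_subsolution_pair (b : OrthonormalBasis ι ℝ E)
    {Q : ℝ → E → ℝ} {H : ℝ → E → ℝ} {𝒯 : Set ℝ} (h𝒯 : IsOpen 𝒯)
    (hQ : ContDiffOn ℝ ∞ (fun p : ℝ × E => Q p.1 p.2) (𝒯 ×ˢ (univ : Set E)))
    (hH : ContinuousOn (fun p : ℝ × E => H p.1 p.2) (𝒯 ×ˢ (univ : Set E)))
    (hQ0 : ∀ ⦃s : ℝ⦄, s ∈ 𝒯 → ∀ y, 0 ≤ Q s y) (hH0 : ∀ ⦃s : ℝ⦄, s ∈ 𝒯 → ∀ y, 0 ≤ H s y)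
    (hkato : ∀ ⦃s : ℝ⦄, s ∈ 𝒯 → ∀ y, ‖fderiv ℝ (Q s) y‖ ^ 2 ≤ 4 * Q s y * H s y)
    {φ : E → ℝ} (hφ : ContDiff ℝ 1 φ) (hφc : HasCompactSupport φ)
    {Kc U : Set E} (hKc : IsCompact Kc) (hUK : U ⊆ Kc) (hU : MeasurableSet U)
    (hφU : ∀ y ∉ U, fderiv ℝ φ y = 0) {K : ℝ} (hK : ∀ y, ‖fderiv ℝ φ y‖ ≤ K)
    {t₁ t₂ : ℝ} (h12 : t₁ ≤ t₂) (hI : Icc t₁ t₂ ⊆ 𝒯) {L : ℝ}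
    (hineq : ∀ s ∈ Icc t₁ t₂, ∀ y, φ y ≠ 0 → deriv (fun s' => Q s' y) s -
        ∑ l, fderiv ℝ (fun z => fderiv ℝ (Q s) z (b l)) y (b l) ≤ -(2 * H s y) + L * Q s y) :
    ∫ s in t₁..t₂, ∫ y, φ y ^ 2 * H s y ≤
      (∫ y, φ y ^ 2 * Q t₁ y) + 4 * K ^ 2 * (∫ s in t₁..t₂, ∫ y in U, Q s y) +
        L * ∫ s in t₁..t₂, ∫ y, φ y ^ 2 * Q s y := by
  have hφcont : Continuous φ := hφ.continuous
  have hφ2c : Continuous fun y => φ y ^ 2 := hφcont.pow 2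
  have hφ2s : HasCompactSupport fun y => φ y ^ 2 := hasCompactSupport_sq hφc
  have hQ_c := hQ.continuousOn
  have hO : IsOpen (𝒯 ×ˢ (univ : Set E)) := h𝒯.prod isOpen_univ
  -- ### the time functions
  set Y : ℝ → ℝ := fun s => ∫ y, φ y ^ 2 * Q s y with hY
  set D : ℝ → ℝ := fun s => ∫ y, φ y ^ 2 * deriv (fun s' => Q s' y) s with hD
  set G : ℝ → ℝ := fun s => ∫ y, φ y ^ 2 * H s y with hG
  set EU : ℝ → ℝ := fun s => ∫ y in U, Q s y with hEU
  have hYc : ContinuousOn Y 𝒯 := continuousOn_integral_mul_of_continuousOn_slab h𝒯 hQ_c hφ2c hφ2s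
  have hGc : ContinuousOn G 𝒯 := continuousOn_integral_mul_of_continuousOn_slab h𝒯 hH hφ2c hφ2s
  have hEUc : ContinuousOn EU 𝒯 := continuousOn_setIntegral_of_continuousOn_slab h𝒯 hQ_c hKc hUK hU
  set rate : ℝ × E → ℝ := fun p => fderiv ℝ (fun q : ℝ × E => Q q.1 q.2) p ((1 : ℝ), (0 : E))
    with hrate
  have hrate_c : ContinuousOn rate (𝒯 ×ˢ (univ : Set E)) :=
    ((ContinuousLinearMap.apply ℝ ℝ ((1 : ℝ), (0 : E))).continuous.comp_continuousOn
      (hQ.continuousOn_fderiv_of_isOpen hO (by simp)))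
  have hrate_eq : ∀ {s : ℝ}, s ∈ 𝒯 → ∀ y, deriv (fun s' => Q s' y) s = rate (s, y) := fun hs y =>
    (hasDerivAt_timeSlice hO hQ (by simp) ⟨hs, mem_univ y⟩).deriv
  have hDc : ContinuousOn D 𝒯 := by
    have h := continuousOn_integral_mul_of_continuousOn_slab h𝒯 hrate_c hφ2c hφ2s
    refine h.congr fun s hs => ?_
    simp only [hD]
    exact integral_congr_ae (ae_of_all _ fun y => by simp only [hrate_eq hs y])
  have hYd : ∀ s ∈ 𝒯, HasDerivAt Y (D s) s := fun s hs =>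
    hasDerivAt_integral_mul_of_contDiffOn h𝒯 hQ hφ2c hφ2s hs
  -- ### the fixed-time inequality on `[t₁, t₂]`
  have hfix : ∀ s ∈ Icc t₁ t₂, G s ≤ -D s + 4 * K ^ 2 * EU s + L * Y s := fun s hs =>
    integral_sq_mul_le_of_subsolution_pair b h𝒯 hQ hH hQ0 hH0 hkato hφ hφc hKc hUK hU hφU hK
      (hI hs) (hineq s hs)
  -- ### integrate in time
  have hIi : ∀ ⦃f : ℝ → ℝ⦄, ContinuousOn f 𝒯 → IntervalIntegrable f volume t₁ t₂ := fun f hf =>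
    ContinuousOn.intervalIntegrable (by rw [uIcc_of_le h12]; exact hf.mono hI)
  have hGi := hIi hGc
  have hDi := hIi hDc
  have hEUi := hIi hEUc
  have hYi := hIi hYc
  have hDn : IntervalIntegrable (fun s => -D s) volume t₁ t₂ := hDi.neg
  have hDE : IntervalIntegrable (fun s => -D s + 4 * K ^ 2 * EU s) volume t₁ t₂ :=
    hDn.add (hEUi.const_mul (4 * K ^ 2))
  have hRi : IntervalIntegrable (fun s => -D s + 4 * K ^ 2 * EU s + L * Y s) volume t₁ t₂ :=
    hDE.add (hYi.const_mul L)
  have hmono := intervalIntegral.integral_mono_on h12 hGi hRi hfix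
  have hsplit : (∫ s in t₁..t₂, (-D s + 4 * K ^ 2 * EU s + L * Y s)) =
      -(∫ s in t₁..t₂, D s) + 4 * K ^ 2 * (∫ s in t₁..t₂, EU s) + L * ∫ s in t₁..t₂, Y s := by
    rw [intervalIntegral.integral_add hDE (hYi.const_mul L),
      intervalIntegral.integral_add hDn (hEUi.const_mul (4 * K ^ 2)),
      intervalIntegral.integral_neg, intervalIntegral.integral_const_mul,
      intervalIntegral.integral_const_mul]
  have hFTC : (∫ s in t₁..t₂, D s) = Y t₂ - Y t₁ :=
    intervalIntegral.integral_eq_sub_of_hasDerivAt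
      (fun s hs => hYd s (hI (by rwa [uIcc_of_le h12] at hs))) hDi
  have hY2 : 0 ≤ Y t₂ := integral_nonneg fun y => mul_nonneg (sq_nonneg _)
    (hQ0 (hI (right_mem_Icc.2 h12)) y)
  rw [hsplit, hFTC] at hmono
  simp only [hG, hY, hEU] at hmono ⊢
  linarith only [hmono, hY2]

end ScalarEnergy

end Literature.MathematicalPhysics.QuantumLattice
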